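import Mathlib.Data.Real.Basic
import Mathlib.Algebra.Order.Field.Basic
import Mathlib.Algebra.BigOperators.Field
import Mathlib.Data.Fintype.Powerset
import Mathlib.Order.UpperLower.Basic
import Mathlib.Algebra.Order.BigOperators.Group.Finset
import Mathlib.Tactic.Linarith
import Mathlib.Tactic.Positivity
import Mathlib.Tactic.FieldSimp
import Mathlib.Tactic.Ring
import Literature.Computability.Complexity.ClosedFamilies
import HarnessLib

/-!
# Closed monotone functions, the closure operator and trimming (Cavalar–Kumar–Rossman, §2.4–2.5)

The lattice-theoretic part of the Cavalar–Kumar–Rossman proof of the `2^{Ω(√n / log n)}`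
monotone lower bound for the Harnik–Raz function (Algorithmica 84 (2022), §2), over an arbitrary
finite set of variables `V`. A monotone Boolean function on `{0,1}^V` is represented by its
*up-set* of accepted supports `𝒯 ⊆ 𝒫(V)` (`IsUpperSet ↑𝒯`; `x_U` is accepted iff `U ∈ 𝒯`),
its minterms are the minimal members `Razborov.minimals 𝒯` (`ClosedFamilies.lean`), and the
negative test distribution `𝐍` of CKR (Def. 2.2: the uniform input) is the uniform distribution on
`𝒫(V)`, `prHalf E = #{U : E U} / 2^{|V|}`.

* `prHalf` and its calculus (monotonicity, union bound, complements, `Pr[i ∈ 𝐍] = 1/2`);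
* `IsClosedFam c ε 𝒯` — CKR Def. 2.6: for `|A| ≤ c`, `Pr[𝒯(𝐍 ∪ A)] > 1 - ε ⇒ A ∈ 𝒯`;
* `closure c ε 𝒮` — CKR Def. 2.8, the least closed up-set containing `𝒮` (as the intersection
  of all of them; `subset_closure`, `isUpperSet_closure`, `isClosedFam_closure`,
  `closure_subset`);
* `prHalf_not_mem_and_mem_closure_le` — **CKR Lemma 2.10** (approximation by closure):
  `Pr[𝐍 ∉ 𝒮 ∧ 𝐍 ∈ cl(𝒮)] ≤ ε · #{A : |A| ≤ c}` (the printed bound `n^{-c}` is this with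
  `ε = n^{-2c}` and `∑_{j ≤ c} (n choose j) ≤ n^c`);
* `isClosedFam_containing` — **CKR Lemma 2.12** (input functions are closed, for `ε ≤ 1/2`);
* `trim c 𝒯` — CKR Def. 2.13 (keep the minterms of size `≤ c/2`), `minimals_trim`,
  `minimals_union`, `minimals_inter`, and the two containments behind CKR Lemmas 2.15/2.16:
  `exists_minimal_of_mem_trim`, `exists_minimal_of_mem_of_not_mem_trim`.

The bound on the number of minterms of a closed function (CKR Lemma 2.11, via the robust
sunflower / spread lemma) is in `ClosedFewMinterms.lean`; the circuit lower bound in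
`HarnikRazLowerBound.lean`.

## References

* B. P. Cavalar, M. Kumar, B. Rossman, *Monotone circuit lower bounds from robust sunflowers*,
  Algorithmica 84 (2022) 3655–3685, §2.4–2.5 (Defs. 2.6, 2.8, 2.13; Lemmas 2.10, 2.12, 2.15,
  2.16) [CavalarKumarRossman2022].
-/

namespace Literature.Computability.Complexity.CKR

open Finset Razborov

variable {V : Type*} [Fintype V] [DecidableEq V]

/-! ### The uniform negative test distribution -/

/-- `Pr[E(𝐍)]` for the uniform random input `𝐍 ∈ {0,1}^V` (CKR Def. 2.2), inputs being
identified with their supports: the fraction of subsets `U ⊆ V` with `E U`.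
[cite: CavalarKumarRossman2022, Def. 2.2] -/
noncomputable def prHalf (E : Finset V → Prop) [DecidablePred E] : ℝ :=
  #(univ.filter E) / 2 ^ Fintype.card V

omit [DecidableEq V] in
/-- The number of inputs is `2^{|V|}`. [folklore] -/
theorem card_univ_finset : (#(univ : Finset (Finset V)) : ℝ) = 2 ^ Fintype.card V := by
  rw [card_univ, Fintype.card_finset]; push_cast; rfl

omit [DecidableEq V] in
/-- Probabilities are nonnegative. [folklore] -/
theorem prHalf_nonneg (E : Finset V → Prop) [DecidablePred E] : 0 ≤ prHalf E := by
  unfold prHalf; positivity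

omit [DecidableEq V] in
/-- Probabilities are at most `1`. [folklore] -/
theorem prHalf_le_one (E : Finset V → Prop) [DecidablePred E] : prHalf E ≤ 1 := by
  unfold prHalf
  rw [div_le_one (by positivity), ← card_univ_finset]
  exact_mod_cast card_le_card (filter_subset _ _)

omit [DecidableEq V] in
/-- Monotonicity of probability. [folklore] -/
theorem prHalf_mono {E E' : Finset V → Prop} [DecidablePred E] [DecidablePred E']
    (h : ∀ U, E U → E' U) : prHalf E ≤ prHalf E' := by
  unfold prHalf
  refine div_le_div_of_nonneg_right ?_ (by positivity)
  exact_mod_cast card_le_card (monotone_filter_right _ fun U _ hU => h U hU)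

/-- The union bound for two events. [folklore] -/
theorem prHalf_le_add {E E₁ E₂ : Finset V → Prop} [DecidablePred E] [DecidablePred E₁]
    [DecidablePred E₂] (h : ∀ U, E U → E₁ U ∨ E₂ U) : prHalf E ≤ prHalf E₁ + prHalf E₂ := by
  unfold prHalf
  rw [← add_div]
  refine div_le_div_of_nonneg_right ?_ (by positivity)
  have hsub : univ.filter E ⊆ univ.filter E₁ ∪ univ.filter E₂ := by
    intro U hU
    rw [mem_union, mem_filter, mem_filter]
    rcases h U (mem_filter.1 hU).2 with h' | h'
    · exact Or.inl ⟨mem_univ _, h'⟩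
    · exact Or.inr ⟨mem_univ _, h'⟩
  exact_mod_cast (card_le_card hsub).trans (card_union_le _ _)

/-- The union bound over a finite family of events. [folklore] -/
theorem prHalf_exists_le_sum {γ : Type*} [DecidableEq γ] (s : Finset γ) (E : γ → Finset V → Prop)
    [∀ a, DecidablePred (E a)] :
    prHalf (fun U => ∃ a ∈ s, E a U) ≤ ∑ a ∈ s, prHalf (E a) := by
  unfold prHalf
  rw [← sum_div]
  refine div_le_div_of_nonneg_right ?_ (by positivity)
  have hsub : univ.filter (fun U => ∃ a ∈ s, E a U) ⊆ s.biUnion fun a => univ.filter (E a) := by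
    intro U hU
    obtain ⟨a, ha, hE⟩ := (mem_filter.1 hU).2
    exact mem_biUnion.2 ⟨a, ha, mem_filter.2 ⟨mem_univ _, hE⟩⟩
  exact_mod_cast (card_le_card hsub).trans card_biUnion_le

omit [DecidableEq V] in
/-- Complements: `Pr[¬ E] = 1 - Pr[E]`. [folklore] -/
theorem prHalf_not (E : Finset V → Prop) [DecidablePred E] :
    prHalf (fun U => ¬ E U) = 1 - prHalf E := by
  unfold prHalf
  have h := Finset.card_filter_add_card_filter_not (s := (univ : Finset (Finset V))) E
  have h2 : (2 : ℝ) ^ Fintype.card V ≠ 0 := by positivity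
  rw [eq_sub_iff_add_eq, ← add_div, add_comm, div_eq_one_iff_eq h2, ← card_univ_finset]
  exact_mod_cast h

omit [DecidableEq V] in
/-- An event that never happens has probability `0`. [folklore] -/
theorem prHalf_eq_zero {E : Finset V → Prop} [DecidablePred E] (h : ∀ U, ¬ E U) : prHalf E = 0 := by
  unfold prHalf
  rw [filter_eq_empty_iff.2 fun U _ => h U, card_empty, Nat.cast_zero, zero_div]

/-- **Each variable is on with probability `1/2`** under the uniform input. [folklore] -/
theorem prHalf_mem (i : V) : prHalf (fun U : Finset V => i ∈ U) = 1 / 2 := by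
  have hbij : #(univ.filter fun U : Finset V => i ∈ U) = #(univ.filter fun U : Finset V => ¬ i ∈ U) := by
    refine card_bij (fun U _ => U.erase i) (fun U hU => ?_) (fun U₁ h₁ U₂ h₂ h => ?_) (fun U hU => ?_)
    · exact mem_filter.2 ⟨mem_univ _, notMem_erase i U⟩
    · have h₁' := (mem_filter.1 h₁).2
      have h₂' := (mem_filter.1 h₂).2
      rw [← insert_erase h₁', ← insert_erase h₂', h]
    · refine ⟨insert i U, mem_filter.2 ⟨mem_univ _, mem_insert_self i U⟩, ?_⟩
      exact erase_insert (mem_filter.1 hU).2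
  have htot := Finset.card_filter_add_card_filter_not (s := (univ : Finset (Finset V)))
    (fun U : Finset V => i ∈ U)
  rw [← hbij] at htot
  unfold prHalf
  have h2 : (2 : ℝ) ^ Fintype.card V ≠ 0 := by positivity
  rw [div_eq_iff h2, ← card_univ_finset]
  have : (#(univ.filter fun U : Finset V => i ∈ U) : ℝ) + #(univ.filter fun U : Finset V => i ∈ U)
      = #(univ : Finset (Finset V)) := by exact_mod_cast htot
  linarith

/-! ### Closed families and the closure operator -/

/-- **Closed monotone functions** (CKR Def. 2.6, parameters `c` and `ε`): the up-set `𝒯` is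
*closed* if for every `A` with `|A| ≤ c`, `Pr[𝐍 ∪ A ∈ 𝒯] > 1 - ε` forces `A ∈ 𝒯`.
[cite: CavalarKumarRossman2022, Def. 2.6] -/
def IsClosedFam (c : ℕ) (ε : ℝ) (𝒯 : Finset (Finset V)) : Prop :=
  ∀ A : Finset V, #A ≤ c → 1 - ε < prHalf (fun U => A ∪ U ∈ 𝒯) → A ∈ 𝒯

open Classical in
/-- **The closure operator** (CKR Def. 2.8): the least closed up-set containing `𝒮`, defined as
the intersection of all closed up-sets containing `𝒮` (the whole power set is one; closed
up-sets are stable under intersection, CKR Rem. 2.9). [cite: CavalarKumarRossman2022, Def. 2.8] -/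
noncomputable def closure (c : ℕ) (ε : ℝ) (𝒮 : Finset (Finset V)) : Finset (Finset V) :=
  univ.filter fun A => ∀ 𝒯 : Finset (Finset V), 𝒮 ⊆ 𝒯 → IsUpperSet (𝒯 : Set (Finset V)) →
    IsClosedFam c ε 𝒯 → A ∈ 𝒯

/-- Membership in the closure. [cite: CavalarKumarRossman2022, Def. 2.8] -/
theorem mem_closure {c : ℕ} {ε : ℝ} {𝒮 : Finset (Finset V)} {A : Finset V} :
    A ∈ closure c ε 𝒮 ↔ ∀ 𝒯 : Finset (Finset V), 𝒮 ⊆ 𝒯 → IsUpperSet (𝒯 : Set (Finset V)) →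
      IsClosedFam c ε 𝒯 → A ∈ 𝒯 := by
  classical
  simp [closure]

/-- `𝒮 ⊆ cl(𝒮)`. [cite: CavalarKumarRossman2022, Def. 2.8] -/
theorem subset_closure (c : ℕ) (ε : ℝ) (𝒮 : Finset (Finset V)) : 𝒮 ⊆ closure c ε 𝒮 :=
  fun _ hA => mem_closure.2 fun _ h𝒮 _ _ => h𝒮 hA

/-- The closure is an up-set. [cite: CavalarKumarRossman2022, Def. 2.8] -/
theorem isUpperSet_closure (c : ℕ) (ε : ℝ) (𝒮 : Finset (Finset V)) :
    IsUpperSet (closure c ε 𝒮 : Set (Finset V)) := by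
  intro A B hAB hA
  rw [mem_coe, mem_closure] at hA ⊢
  exact fun 𝒯 h1 h2 h3 => h2 hAB (hA 𝒯 h1 h2 h3)

/-- The closure is contained in every closed up-set containing `𝒮` (minimality).
[cite: CavalarKumarRossman2022, Def. 2.8] -/
theorem closure_subset {c : ℕ} {ε : ℝ} {𝒮 𝒯 : Finset (Finset V)} (h1 : 𝒮 ⊆ 𝒯)
    (h2 : IsUpperSet (𝒯 : Set (Finset V))) (h3 : IsClosedFam c ε 𝒯) : closure c ε 𝒮 ⊆ 𝒯 :=
  fun _ hA => mem_closure.1 hA 𝒯 h1 h2 h3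

/-- The closure is closed (CKR Rem. 2.9: intersections of closed up-sets are closed).
[cite: CavalarKumarRossman2022, Rem. 2.9] -/
theorem isClosedFam_closure (c : ℕ) (ε : ℝ) (𝒮 : Finset (Finset V)) :
    IsClosedFam c ε (closure c ε 𝒮) := by
  intro A hA hpr
  refine mem_closure.2 fun 𝒯 h1 h2 h3 => h3 A hA (hpr.trans_le ?_)
  exact prHalf_mono fun U hU => closure_subset h1 h2 h3 hU

/-- The sets of size at most `c` outside `𝒯` (the possible steps of the closure process of CKR
Lemma 2.10). [cite: CavalarKumarRossman2022, Lemma 2.10] -/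
def smallOut (c : ℕ) (𝒯 : Finset (Finset V)) : Finset (Finset V) :=
  (univ.filter fun A : Finset V => #A ≤ c).filter fun A => A ∉ 𝒯

/-- **CKR Lemma 2.10, inductive form**: for an up-set `𝒯` between `𝒮` and its closure,
`Pr[𝐍 ∉ 𝒯 ∧ 𝐍 ∈ cl(𝒮)] ≤ ε · #{A : |A| ≤ c, A ∉ 𝒯}` — add a violating `A` to `𝒯` at cost `< ε`
and recurse. [cite: CavalarKumarRossman2022, Lemma 2.10] -/
theorem prHalf_not_mem_and_mem_closure_le_aux {c : ℕ} {ε : ℝ} (hε : 0 ≤ ε) (𝒮 : Finset (Finset V)) :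
    ∀ (m : ℕ) (𝒯 : Finset (Finset V)), IsUpperSet (𝒯 : Set (Finset V)) → 𝒮 ⊆ 𝒯 →
      𝒯 ⊆ closure c ε 𝒮 → #(smallOut c 𝒯) ≤ m →
      prHalf (fun U => U ∉ 𝒯 ∧ U ∈ closure c ε 𝒮) ≤ ε * #(smallOut c 𝒯) := by
  intro m
  induction m with
  | zero =>
    intro 𝒯 hup h𝒮 hcl hm
    -- no small set is missing, so `𝒯` is closed and equals the closure on the event
    have hclosed : IsClosedFam c ε 𝒯 := by
      intro A hA _
      by_contra hAT
      have : A ∈ smallOut c 𝒯 := mem_filter.2 ⟨mem_filter.2 ⟨mem_univ _, hA⟩, hAT⟩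
      rw [Nat.le_zero, card_eq_zero] at hm
      rw [hm] at this
      exact absurd this (notMem_empty A)
    rw [prHalf_eq_zero fun U ⟨h1, h2⟩ => h1 (closure_subset h𝒮 hup hclosed h2)]
    positivity
  | succ m ih =>
    intro 𝒯 hup h𝒮 hcl hm
    by_cases hclosed : IsClosedFam c ε 𝒯
    · rw [prHalf_eq_zero fun U ⟨h1, h2⟩ => h1 (closure_subset h𝒮 hup hclosed h2)]
      positivity
    -- a violating set `A`
    simp only [IsClosedFam, not_forall, exists_prop] at hclosed
    obtain ⟨A, hAc, hApr, hAT⟩ := hclosed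
    set 𝒯' : Finset (Finset V) := 𝒯 ∪ univ.filter fun B => A ⊆ B with h𝒯'
    have hup' : IsUpperSet (𝒯' : Set (Finset V)) := by
      intro B B' hBB' hB
      rw [mem_coe, h𝒯', mem_union] at hB ⊢
      rcases hB with hB | hB
      · exact Or.inl (hup hBB' hB)
      · exact Or.inr (mem_filter.2 ⟨mem_univ _, (mem_filter.1 hB).2.trans hBB'⟩)
    have h𝒮' : 𝒮 ⊆ 𝒯' := h𝒮.trans subset_union_left
    have hAcl : A ∈ closure c ε 𝒮 :=
      isClosedFam_closure c ε 𝒮 A hAc (hApr.trans_le (prHalf_mono fun U hU => hcl hU))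
    have hcl' : 𝒯' ⊆ closure c ε 𝒮 := by
      refine union_subset hcl fun B hB => ?_
      exact isUpperSet_closure c ε 𝒮 (mem_filter.1 hB).2 hAcl
    -- the measure of missing small sets drops
    have hsub : smallOut c 𝒯' ⊆ smallOut c 𝒯 := by
      intro B hB
      obtain ⟨hB1, hB2⟩ := mem_filter.1 hB
      exact mem_filter.2 ⟨hB1, fun h => hB2 (mem_union_left _ h)⟩
    have hAin : A ∈ smallOut c 𝒯 := mem_filter.2 ⟨mem_filter.2 ⟨mem_univ _, hAc⟩, hAT⟩
    have hAout : A ∉ smallOut c 𝒯' := fun h =>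
      (mem_filter.1 h).2 (mem_union_right _ (mem_filter.2 ⟨mem_univ _, Subset.refl A⟩))
    have hcard : #(smallOut c 𝒯') + 1 ≤ #(smallOut c 𝒯) := by
      have : smallOut c 𝒯' ⊂ smallOut c 𝒯 :=
        Finset.ssubset_iff_subset_ne.2 ⟨hsub, fun h => hAout (h ▸ hAin)⟩
      exact card_lt_card this
    have hIH := ih 𝒯' hup' h𝒮' hcl' (by omega)
    -- the new error
    have herr : prHalf (fun U => U ∈ 𝒯' ∧ U ∉ 𝒯) ≤ ε := by
      have h1 : prHalf (fun U => U ∈ 𝒯' ∧ U ∉ 𝒯) ≤ prHalf (fun U => ¬ (A ∪ U ∈ 𝒯)) := by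
        refine prHalf_mono fun U ⟨hU1, hU2⟩ => ?_
        rw [h𝒯', mem_union] at hU1
        rcases hU1 with hU1 | hU1
        · exact absurd hU1 hU2
        · rwa [union_eq_right.2 (mem_filter.1 hU1).2]
      rw [prHalf_not] at h1
      linarith
    calc prHalf (fun U => U ∉ 𝒯 ∧ U ∈ closure c ε 𝒮)
        ≤ prHalf (fun U => U ∉ 𝒯' ∧ U ∈ closure c ε 𝒮) + prHalf (fun U => U ∈ 𝒯' ∧ U ∉ 𝒯) := by
          refine prHalf_le_add fun U ⟨hU1, hU2⟩ => ?_
          by_cases hU : U ∈ 𝒯'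
          · exact Or.inr ⟨hU, hU1⟩
          · exact Or.inl ⟨hU, hU2⟩
      _ ≤ ε * #(smallOut c 𝒯') + ε := add_le_add hIH herr
      _ ≤ ε * #(smallOut c 𝒯) := by
          have : (#(smallOut c 𝒯') : ℝ) + 1 ≤ #(smallOut c 𝒯) := by exact_mod_cast hcard
          nlinarith

/-- **CKR Lemma 2.10** (approximation by closure): for an up-set `𝒮`,
`Pr[𝐍 ∉ 𝒮 ∧ 𝐍 ∈ cl(𝒮)] ≤ ε · #{A ⊆ V : |A| ≤ c}`. [cite: CavalarKumarRossman2022, Lemma 2.10] -/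
theorem prHalf_not_mem_and_mem_closure_le {c : ℕ} {ε : ℝ} (hε : 0 ≤ ε) (𝒮 : Finset (Finset V))
    (h𝒮 : IsUpperSet (𝒮 : Set (Finset V))) :
    prHalf (fun U => U ∉ 𝒮 ∧ U ∈ closure c ε 𝒮) ≤ ε * #(univ.filter fun A : Finset V => #A ≤ c) := by
  have h := prHalf_not_mem_and_mem_closure_le_aux hε 𝒮 _ 𝒮 h𝒮 Subset.rfl (subset_closure c ε 𝒮) le_rfl
  refine h.trans (mul_le_mul_of_nonneg_left ?_ hε)
  exact_mod_cast card_le_card (filter_subset _ _)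

/-! ### Input functions -/

/-- The up-set of the input function `x_i`: the supports containing `i`. [cite: CavalarKumarRossman2022, Lemma 2.12] -/
def containing (i : V) : Finset (Finset V) := univ.filter fun A => i ∈ A

/-- Membership in `containing i`. [cite: CavalarKumarRossman2022, Lemma 2.12] -/
@[simp] theorem mem_containing {i : V} {A : Finset V} : A ∈ containing i ↔ i ∈ A := by
  simp [containing]

/-- `containing i` is an up-set. [cite: CavalarKumarRossman2022, Lemma 2.12] -/
theorem isUpperSet_containing (i : V) : IsUpperSet (containing i : Set (Finset V)) := by
  intro A B hAB hA
  rw [mem_coe, mem_containing] at hA ⊢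
  exact hAB hA

/-- **CKR Lemma 2.12** (input functions are closed): for `ε ≤ 1/2`, the up-set of `x_i` is
closed, since `Pr[i ∈ 𝐍] = 1/2 ≤ 1 - ε`. [cite: CavalarKumarRossman2022, Lemma 2.12] -/
theorem isClosedFam_containing {ε : ℝ} (hε : ε ≤ 1 / 2) (c : ℕ) (i : V) :
    IsClosedFam c ε (containing i) := by
  intro A _ hpr
  by_contra hA
  rw [mem_containing] at hA
  have hset : (univ.filter fun U : Finset V => A ∪ U ∈ containing i)
      = univ.filter fun U : Finset V => i ∈ U := by
    ext U
    simp [hA]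
  have : prHalf (fun U : Finset V => A ∪ U ∈ containing i) = prHalf (fun U : Finset V => i ∈ U) := by
    unfold prHalf
    rw [hset]
  rw [this, prHalf_mem] at hpr
  linarith

/-- The minimal members of `containing i`: only `{i}`. [cite: CavalarKumarRossman2022, §2.6] -/
theorem minimals_containing (i : V) : minimals (containing i) = {{i}} := by
  ext A
  rw [mem_minimals, mem_singleton, mem_containing]
  constructor
  · rintro ⟨hi, hmin⟩
    exact (hmin {i} (mem_containing.2 (mem_singleton_self i)) (singleton_subset_iff.2 hi)).symm
  · rintro rfl
    exact ⟨mem_singleton_self i, fun B hB hBi =>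
      Subset.antisymm hBi (singleton_subset_iff.2 (mem_containing.1 hB))⟩

/-! ### Minterms of unions and intersections -/

omit [Fintype V] in
/-- Minterms of `f ∨ g` are minterms of `f` or of `g`. [folklore] -/
theorem minimals_union {𝒜 ℬ : Finset (Finset V)} {B : Finset V} (h : B ∈ minimals (𝒜 ∪ ℬ)) :
    B ∈ minimals 𝒜 ∨ B ∈ minimals ℬ := by
  obtain ⟨hB, hmin⟩ := mem_minimals.1 h
  rcases mem_union.1 hB with hB' | hB'
  · left
    obtain ⟨M, hM, hMB⟩ := exists_minimal_subset hB'
    rw [← hmin M (mem_union_left _ (minimals_subset _ hM)) hMB]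
    exact hM
  · right
    obtain ⟨M, hM, hMB⟩ := exists_minimal_subset hB'
    rw [← hmin M (mem_union_right _ (minimals_subset _ hM)) hMB]
    exact hM

omit [Fintype V] in
/-- Minterms of `f ∧ g` (up-sets) are unions of a minterm of `f` and a minterm of `g`.
[folklore] -/
theorem minimals_inter {𝒜 ℬ : Finset (Finset V)} (h𝒜 : IsUpperSet (𝒜 : Set (Finset V)))
    (hℬ : IsUpperSet (ℬ : Set (Finset V))) {B : Finset V} (h : B ∈ minimals (𝒜 ∩ ℬ)) :
    ∃ M₁ ∈ minimals 𝒜, ∃ M₂ ∈ minimals ℬ, B = M₁ ∪ M₂ := by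
  obtain ⟨hB, hmin⟩ := mem_minimals.1 h
  obtain ⟨hB𝒜, hBℬ⟩ := mem_inter.1 hB
  obtain ⟨M₁, hM₁, hM₁B⟩ := exists_minimal_subset hB𝒜
  obtain ⟨M₂, hM₂, hM₂B⟩ := exists_minimal_subset hBℬ
  refine ⟨M₁, hM₁, M₂, hM₂, (hmin (M₁ ∪ M₂) (mem_inter.2 ⟨?_, ?_⟩) (union_subset hM₁B hM₂B)).symm⟩
  · exact h𝒜 (subset_union_left (s₁ := M₁) (s₂ := M₂)) (minimals_subset _ hM₁)
  · exact hℬ (subset_union_right (s₁ := M₁) (s₂ := M₂)) (minimals_subset _ hM₂)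

/-! ### Trimming -/

/-- **Trimming** (CKR Def. 2.13): `trim(f) = ⋁ {⌈A⌉ : A a minterm of f, |A| ≤ c/2}`, as the
up-set generated by the small minterms of `𝒯`. [cite: CavalarKumarRossman2022, Def. 2.13] -/
noncomputable def trim (c : ℕ) (𝒯 : Finset (Finset V)) : Finset (Finset V) :=
  univ.filter fun B => ∃ A ∈ minimals 𝒯, #A ≤ c / 2 ∧ A ⊆ B

/-- Membership in the trimming. [cite: CavalarKumarRossman2022, Def. 2.13] -/
theorem mem_trim {c : ℕ} {𝒯 : Finset (Finset V)} {B : Finset V} :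
    B ∈ trim c 𝒯 ↔ ∃ A ∈ minimals 𝒯, #A ≤ c / 2 ∧ A ⊆ B := by
  simp [trim]

/-- `trim(f) ≤ f` for monotone `f`. [cite: CavalarKumarRossman2022, Def. 2.13] -/
theorem trim_subset {c : ℕ} {𝒯 : Finset (Finset V)} (h𝒯 : IsUpperSet (𝒯 : Set (Finset V))) :
    trim c 𝒯 ⊆ 𝒯 := by
  intro B hB
  obtain ⟨A, hA, -, hAB⟩ := mem_trim.1 hB
  exact h𝒯 hAB (minimals_subset _ hA)

/-- The trimming is an up-set. [cite: CavalarKumarRossman2022, Def. 2.13] -/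
theorem isUpperSet_trim (c : ℕ) (𝒯 : Finset (Finset V)) : IsUpperSet (trim c 𝒯 : Set (Finset V)) := by
  intro B B' hBB' hB
  rw [mem_coe, mem_trim] at hB ⊢
  obtain ⟨A, hA, hAc, hAB⟩ := hB
  exact ⟨A, hA, hAc, hAB.trans hBB'⟩

/-- Small minterms survive trimming. [cite: CavalarKumarRossman2022, Def. 2.13] -/
theorem mem_trim_of_mem_minimals {c : ℕ} {𝒯 : Finset (Finset V)} {A : Finset V}
    (hA : A ∈ minimals 𝒯) (hAc : #A ≤ c / 2) : A ∈ trim c 𝒯 :=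
  mem_trim.2 ⟨A, hA, hAc, Subset.refl A⟩

/-- **The minterms of `trim(f)` are the minterms of `f` of size `≤ c/2`** (CKR Rem. 2.14).
[cite: CavalarKumarRossman2022, Rem. 2.14] -/
theorem minimals_trim {c : ℕ} {𝒯 : Finset (Finset V)} {B : Finset V} (hB : B ∈ minimals (trim c 𝒯)) :
    B ∈ minimals 𝒯 ∧ #B ≤ c / 2 := by
  obtain ⟨hBt, hmin⟩ := mem_minimals.1 hB
  obtain ⟨A, hA, hAc, hAB⟩ := mem_trim.1 hBt
  have hBA : A = B := hmin A (mem_trim_of_mem_minimals hA hAc) hAB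
  subst hBA
  exact ⟨hA, hAc⟩

/-- **Containment behind CKR Lemma 2.15**: if `∅ ∉ trim(f)` (i.e. `trim(f) ≢ 1`), an input
accepted by `trim(f)` contains a minterm of `f` of size between `1` and `c/2`.
[cite: CavalarKumarRossman2022, Lemma 2.15] -/
theorem exists_minimal_of_mem_trim {c : ℕ} {𝒯 : Finset (Finset V)} (h0 : ∅ ∉ trim c 𝒯) {U : Finset V}
    (hU : U ∈ trim c 𝒯) : ∃ A ∈ minimals 𝒯, 1 ≤ #A ∧ #A ≤ c / 2 ∧ A ⊆ U := by
  obtain ⟨A, hA, hAc, hAU⟩ := mem_trim.1 hU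
  refine ⟨A, hA, ?_, hAc, hAU⟩
  rw [Nat.one_le_iff_ne_zero, Ne, card_eq_zero]
  rintro rfl
  exact h0 (mem_trim_of_mem_minimals hA hAc)

/-- **Containment behind CKR Lemmas 2.16/2.18**: if the up-set `ℋ` has all minterms of size
`≤ c` and `h = cl(ℋ)`, an input accepted by `ℋ` but rejected by `trim(h)` contains a minterm of
`h` of size in `(c/2, c]`. [cite: CavalarKumarRossman2022, Lemma 2.16] -/
theorem exists_minimal_of_mem_of_not_mem_trim {c : ℕ} {ε : ℝ} {ℋ : Finset (Finset V)}
    (hℋ : ∀ A ∈ minimals ℋ, #A ≤ c) {U : Finset V} (hU : U ∈ ℋ) (hUt : U ∉ trim c (closure c ε ℋ)) :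
    ∃ A ∈ minimals (closure c ε ℋ), c / 2 < #A ∧ #A ≤ c ∧ A ⊆ U := by
  obtain ⟨A', hA', hA'U⟩ := exists_minimal_subset hU
  obtain ⟨A, hA, hAA'⟩ := exists_minimal_subset (subset_closure c ε ℋ (minimals_subset _ hA'))
  have hAc : #A ≤ c := (card_le_card hAA').trans (hℋ A' hA')
  refine ⟨A, hA, ?_, hAc, hAA'.trans hA'U⟩
  by_contra hlt
  exact hUt (mem_trim.2 ⟨A, hA, not_lt.1 hlt, hAA'.trans hA'U⟩)

end Literature.Computability.Complexity.CKR
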